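import Summits.NavierStokesRegularity.NavierStokesRegularity.Theorems.ExtremiserTransienceTwoThirdsRemainderField
import Summits.NavierStokesRegularity.NavierStokesRegularity.Theorems.ExtremiserTransienceTwoThirdsPieceExcessAdm
import Summits.NavierStokesRegularity.NavierStokesRegularity.Theorems.ExtremiserTransienceTwoThirdsPieceExcessSet
import HarnessLib

/-!
# Route `ExtremiserTransience`, crux `NearExtremalTransiencePerFlow` (stmt-NavierStokesRegularity-26567),
# LINE g10-1 «two_thirds» (ns-idea-10), stub S1a′ — BRICK 2, lemma P4e: THE EXCESS OF THE REMAINDER OF A PACKING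

`--supports stmt-NavierStokesRegularity-26567` (helper; prover seat ns-net-p2 g13).  For a `3ρ⁸`-separated finite family `F` of cells with
pieces `φ c` and weights `χ c` satisfying the clauses of `cell_piece` (p734300), the remainder region `R = (⋃_c B(c, ρ⁸))ᶜ` obeys the
localised sharp inequality with excess: `remainder_offsets` (the offsets of `φ_R = w − Σφ_c` vanish off `⋃ L_c`, are square integrable with
`∫ ≤ #F·Cc/ρ²`, `Σ_c Cc S_c/ρ²`) and `remainder_excess`:

  `J_R − κ⋆√(Z_R W_R) ≤ κ⋆((m/2)(Z_B+P+W_B+Q) + (t/2)(Z_B+W_B) + (1/(2t)+½)(P+Q)) + 2A₁Z_L + 2A₁j₁ + m(Z_B+P) + A₁Z_L`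

with `B = (⋃ B(c,ρ⁸+ρ⁷))ᶜ ⊆ R`, `Z_L = Z_R − Z_B`, `m = Cc/ρ²`, `j₁ = #F·Cc/ρ²`, `j₂ = Σ_c Cc·S_c/ρ²`, `P = 2Z_L+2j₁`, `Q = 2W_L+6j₂`
(`piece_excess_adm` p734422 for the admissible field `w + (−1)•Σφ_c`, `admissible_add_smul`, then `outer_excess_le` p733927).
HONEST FRAMING: nothing about Navier–Stokes is proved; no summit is proved by a line. [folklore]
-/

noncomputable section

open scoped Topology InnerProductSpace RealInnerProductSpace ENNReal NNReal ContDiff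
open MeasureTheory Filter Set Metric
open Literature.Analysis.FluidPDE
open Summit.NavierStokesRegularity.NavierStokesRegularity.Theorems.DepletionLadder.KStar.HalfSpace
open Summit.NavierStokesRegularity.NavierStokesRegularity.Theorems.DepletionLadder
open Summit.NavierStokesRegularity.NavierStokesRegularity.Theorems.NearExtremalTransiencePerFlow.LocalMaximiser

namespace Summit.NavierStokesRegularity.NavierStokesRegularity.Theorems.NearExtremalTransiencePerFlow.TwoThirds

-- the summit's namespace repeats the problem name by convention (D-0017)
set_option linter.dupNamespace false

section RemainderExcess

variable {w : E3 → E3} {ρ Cc : ℝ} {F : Finset E3} {φ : E3 → E3 → E3} {χ : E3 → E3 → ℝ} {S : E3 → ℝ}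

/-- **Offsets of the remainder**: they vanish off `(⋃B(c,ρ⁸))ᶜ ∖ (⋃B(c,ρ⁸+ρ⁷))ᶜ`, are square integrable, and their `L²` norms are the sums
of the cells' ones. [folklore] -/
theorem remainder_offsets (hρ : 2 ≤ ρ) (hsep : ∀ c ∈ F, ∀ c' ∈ F, c ≠ c' → 2 * (3 / 2 * ρ ^ 8) ≤ dist c c')
    (hw : ContDiff ℝ (⊤ : ℕ∞) w) (hφs : ∀ c ∈ F, ContDiff ℝ (⊤ : ℕ∞) (φ c))
    (he1 : ∀ c ∈ F, ∀ x, x ∉ ball c (ρ ^ 8 + ρ ^ 7) \ ball c (ρ ^ 8) → curl (φ c) x - χ c x • curl w x = 0)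
    (hi1 : ∀ c ∈ F, Integrable fun x => ‖curl (φ c) x - χ c x • curl w x‖ ^ 2)
    (hj1 : ∀ c ∈ F, ∫ x, ‖curl (φ c) x - χ c x • curl w x‖ ^ 2 ≤ Cc / ρ ^ 2)
    (he2 : ∀ c ∈ F, ∀ x, x ∉ ball c (ρ ^ 8 + ρ ^ 7) \ ball c (ρ ^ 8) → fderiv ℝ (curl (φ c)) x - χ c x • fderiv ℝ (curl w) x = 0)
    (hi2 : ∀ c ∈ F, Integrable fun x => ‖fderiv ℝ (curl (φ c)) x - χ c x • fderiv ℝ (curl w) x‖ ^ 2)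
    (hj2 : ∀ c ∈ F, ∫ x, ‖fderiv ℝ (curl (φ c)) x - χ c x • fderiv ℝ (curl w) x‖ ^ 2 ≤ Cc * S c / ρ ^ 2) :
    (∀ x, x ∉ (⋃ c ∈ F, ball c (ρ ^ 8))ᶜ \ (⋃ c ∈ F, ball c (ρ ^ 8 + ρ ^ 7))ᶜ →
      curl (fun y => w y + (-1 : ℝ) • ∑ c ∈ F, φ c y) x - (1 - ∑ c ∈ F, χ c x) • curl w x = 0) ∧
    Integrable (fun x => ‖curl (fun y => w y + (-1 : ℝ) • ∑ c ∈ F, φ c y) x - (1 - ∑ c ∈ F, χ c x) • curl w x‖ ^ 2) ∧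
    (∫ x, ‖curl (fun y => w y + (-1 : ℝ) • ∑ c ∈ F, φ c y) x - (1 - ∑ c ∈ F, χ c x) • curl w x‖ ^ 2 ≤ (F.card : ℝ) * (Cc / ρ ^ 2)) ∧
    (∀ x, x ∉ (⋃ c ∈ F, ball c (ρ ^ 8))ᶜ \ (⋃ c ∈ F, ball c (ρ ^ 8 + ρ ^ 7))ᶜ →
      fderiv ℝ (curl fun y => w y + (-1 : ℝ) • ∑ c ∈ F, φ c y) x - (1 - ∑ c ∈ F, χ c x) • fderiv ℝ (curl w) x = 0) ∧
    Integrable (fun x => ‖fderiv ℝ (curl fun y => w y + (-1 : ℝ) • ∑ c ∈ F, φ c y) x - (1 - ∑ c ∈ F, χ c x) • fderiv ℝ (curl w) x‖ ^ 2) ∧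
    (∫ x, ‖fderiv ℝ (curl fun y => w y + (-1 : ℝ) • ∑ c ∈ F, φ c y) x - (1 - ∑ c ∈ F, χ c x) • fderiv ℝ (curl w) x‖ ^ 2 ≤
      ∑ c ∈ F, Cc * S c / ρ ^ 2) := by
  have h32 := rho_layer_le hρ
  -- the cells' offsets vanish off `B(c, 3ρ⁸/2)`
  have hg1 : ∀ c ∈ F, ∀ x, x ∉ ball c (3 / 2 * ρ ^ 8) → curl (φ c) x - χ c x • curl w x = 0 := fun c hc x hx =>
    he1 c hc x fun hL => hx (ball_subset_ball h32 hL.1)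
  have hg2 : ∀ c ∈ F, ∀ x, x ∉ ball c (3 / 2 * ρ ^ 8) → fderiv ℝ (curl (φ c)) x - χ c x • fderiv ℝ (curl w) x = 0 := fun c hc x hx =>
    he2 c hc x fun hL => hx (ball_subset_ball h32 hL.1)
  -- the two offsets of the remainder as (minus) sums, and their squared norms as sums
  have hf1 : (fun x => ‖curl (fun y => w y + (-1 : ℝ) • ∑ c ∈ F, φ c y) x - (1 - ∑ c ∈ F, χ c x) • curl w x‖ ^ 2) =
      fun x => ∑ c ∈ F, ‖curl (φ c) x - χ c x • curl w x‖ ^ 2 := by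
    funext x
    rw [remainder_curl_sub_eq hw hφs x, norm_neg]
    exact norm_sq_sum_eq_of_separated (g := fun c x => curl (φ c) x - χ c x • curl w x) hsep hg1 x
  have hf2 : (fun x => ‖fderiv ℝ (curl fun y => w y + (-1 : ℝ) • ∑ c ∈ F, φ c y) x - (1 - ∑ c ∈ F, χ c x) • fderiv ℝ (curl w) x‖ ^ 2) =
      fun x => ∑ c ∈ F, ‖fderiv ℝ (curl (φ c)) x - χ c x • fderiv ℝ (curl w) x‖ ^ 2 := by
    funext x
    rw [remainder_fderiv_curl_sub_eq hw hφs x, norm_neg]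
    exact norm_sq_sum_eq_of_separated (g := fun c x => fderiv ℝ (curl (φ c)) x - χ c x • fderiv ℝ (curl w) x) hsep hg2 x
  refine ⟨fun x hx => ?_, ?_, ?_, fun x hx => ?_, ?_, ?_⟩
  · rw [remainder_curl_sub_eq hw hφs x, neg_eq_zero]
    exact Finset.sum_eq_zero fun c hc => he1 c hc x (notMem_layer_of_notMem hρ hsep hx hc)
  · rw [hf1]; exact integrable_finsetSum _ fun c hc => hi1 c hc
  · rw [hf1, integral_finsetSum _ fun c hc => hi1 c hc]
    calc ∑ c ∈ F, ∫ x, ‖curl (φ c) x - χ c x • curl w x‖ ^ 2 ≤ ∑ _c ∈ F, Cc / ρ ^ 2 := Finset.sum_le_sum fun c hc => hj1 c hc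
      _ = (F.card : ℝ) * (Cc / ρ ^ 2) := by rw [Finset.sum_const, nsmul_eq_mul]
  · rw [remainder_fderiv_curl_sub_eq hw hφs x, neg_eq_zero]
    exact Finset.sum_eq_zero fun c hc => he2 c hc x (notMem_layer_of_notMem hρ hsep hx hc)
  · rw [hf2]; exact integrable_finsetSum _ fun c hc => hi2 c hc
  · rw [hf2, integral_finsetSum _ fun c hc => hi2 c hc]
    exact Finset.sum_le_sum fun c hc => hj2 c hc

/-- **THE EXCESS OF THE REMAINDER** (see the module docstring). [folklore] -/
theorem remainder_excess {A₁ : ℝ} (hρ : 2 ≤ ρ) (hCc : 0 ≤ Cc) (hsep : ∀ c ∈ F, ∀ c' ∈ F, c ≠ c' → 2 * (3 / 2 * ρ ^ 8) ≤ dist c c')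
    (hw : ContDiff ℝ (⊤ : ℕ∞) w) (hdiv : VectorCalculus.IsDivFree w) (hw1 : ∀ x, ‖w x‖ ≤ 1) (hDw : ∀ x, ‖fderiv ℝ w x‖ ≤ A₁)
    (h0 : ∫⁻ x, ‖iteratedFDeriv ℝ 0 w x‖ₑ ^ 2 < ⊤) (h1 : ∫⁻ x, ‖iteratedFDeriv ℝ 1 w x‖ₑ ^ 2 < ⊤)
    (h2 : ∫⁻ x, ‖iteratedFDeriv ℝ 2 w x‖ₑ ^ 2 < ⊤)
    (hφs : ∀ c ∈ F, ContDiff ℝ (⊤ : ℕ∞) (φ c)) (hφsupp : ∀ c ∈ F, tsupport (φ c) ⊆ ball c (3 / 2 * ρ ^ 8))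
    (hφdiv : ∀ c ∈ F, VectorCalculus.IsDivFree (φ c))
    (hχcont : ∀ c ∈ F, Continuous (χ c)) (hχ01 : ∀ c ∈ F, ∀ x, 0 ≤ χ c x ∧ χ c x ≤ 1)
    (hχone : ∀ c ∈ F, ∀ x ∈ ball c (ρ ^ 8), χ c x = 1) (hχout : ∀ c ∈ F, ∀ x, x ∉ ball c (ρ ^ 8 + ρ ^ 7) → χ c x = 0)
    (hχsupp : ∀ c ∈ F, tsupport (χ c) ⊆ ball c (3 / 2 * ρ ^ 8))
    (hd0 : ∀ c ∈ F, ∀ x, ‖φ c x - χ c x • w x‖ ≤ Cc / ρ ^ 2) (hd0' : ∀ c ∈ F, ∀ x, x ∉ tsupport (χ c) → φ c x - χ c x • w x = 0)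
    (hd1 : ∀ c ∈ F, ∀ x, ‖fderiv ℝ (φ c) x - χ c x • fderiv ℝ w x‖ ≤ Cc / ρ ^ 2)
    (hd1' : ∀ c ∈ F, ∀ x, x ∉ tsupport (χ c) → fderiv ℝ (φ c) x - χ c x • fderiv ℝ w x = 0)
    (he1 : ∀ c ∈ F, ∀ x, x ∉ ball c (ρ ^ 8 + ρ ^ 7) \ ball c (ρ ^ 8) → curl (φ c) x - χ c x • curl w x = 0)
    (hi1 : ∀ c ∈ F, Integrable fun x => ‖curl (φ c) x - χ c x • curl w x‖ ^ 2)
    (hj1 : ∀ c ∈ F, ∫ x, ‖curl (φ c) x - χ c x • curl w x‖ ^ 2 ≤ Cc / ρ ^ 2)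
    (he2 : ∀ c ∈ F, ∀ x, x ∉ ball c (ρ ^ 8 + ρ ^ 7) \ ball c (ρ ^ 8) → fderiv ℝ (curl (φ c)) x - χ c x • fderiv ℝ (curl w) x = 0)
    (hi2 : ∀ c ∈ F, Integrable fun x => ‖fderiv ℝ (curl (φ c)) x - χ c x • fderiv ℝ (curl w) x‖ ^ 2)
    (hj2 : ∀ c ∈ F, ∫ x, ‖fderiv ℝ (curl (φ c)) x - χ c x • fderiv ℝ (curl w) x‖ ^ 2 ≤ Cc * S c / ρ ^ 2) {t : ℝ} (ht : 0 < t) :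
    (∫ x in (⋃ c ∈ F, ball c (ρ ^ 8))ᶜ, sd w x) -
        kStar * Real.sqrt ((∫ x in (⋃ c ∈ F, ball c (ρ ^ 8))ᶜ, zd w x) * (∫ x in (⋃ c ∈ F, ball c (ρ ^ 8))ᶜ, wd w x)) ≤
      kStar * (Cc / ρ ^ 2 / 2 * ((∫ x in (⋃ c ∈ F, ball c (ρ ^ 8 + ρ ^ 7))ᶜ, zd w x) +
          (2 * ((∫ x in (⋃ c ∈ F, ball c (ρ ^ 8))ᶜ, zd w x) - (∫ x in (⋃ c ∈ F, ball c (ρ ^ 8 + ρ ^ 7))ᶜ, zd w x)) +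
            2 * ((F.card : ℝ) * (Cc / ρ ^ 2))) +
          (∫ x in (⋃ c ∈ F, ball c (ρ ^ 8 + ρ ^ 7))ᶜ, wd w x) +
          (2 * ((∫ x in (⋃ c ∈ F, ball c (ρ ^ 8))ᶜ, wd w x) - (∫ x in (⋃ c ∈ F, ball c (ρ ^ 8 + ρ ^ 7))ᶜ, wd w x)) +
            6 * (∑ c ∈ F, Cc * S c / ρ ^ 2))) +
        t / 2 * ((∫ x in (⋃ c ∈ F, ball c (ρ ^ 8 + ρ ^ 7))ᶜ, zd w x) + (∫ x in (⋃ c ∈ F, ball c (ρ ^ 8 + ρ ^ 7))ᶜ, wd w x)) +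
        (1 / (2 * t) + 1 / 2) * ((2 * ((∫ x in (⋃ c ∈ F, ball c (ρ ^ 8))ᶜ, zd w x) - (∫ x in (⋃ c ∈ F, ball c (ρ ^ 8 + ρ ^ 7))ᶜ, zd w x)) +
            2 * ((F.card : ℝ) * (Cc / ρ ^ 2))) +
          (2 * ((∫ x in (⋃ c ∈ F, ball c (ρ ^ 8))ᶜ, wd w x) - (∫ x in (⋃ c ∈ F, ball c (ρ ^ 8 + ρ ^ 7))ᶜ, wd w x)) +
            6 * (∑ c ∈ F, Cc * S c / ρ ^ 2)))) +
      (2 * A₁ * ((∫ x in (⋃ c ∈ F, ball c (ρ ^ 8))ᶜ, zd w x) - (∫ x in (⋃ c ∈ F, ball c (ρ ^ 8 + ρ ^ 7))ᶜ, zd w x)) +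
        2 * A₁ * ((F.card : ℝ) * (Cc / ρ ^ 2))) +
      Cc / ρ ^ 2 * ((∫ x in (⋃ c ∈ F, ball c (ρ ^ 8 + ρ ^ 7))ᶜ, zd w x) +
        (2 * ((∫ x in (⋃ c ∈ F, ball c (ρ ^ 8))ᶜ, zd w x) - (∫ x in (⋃ c ∈ F, ball c (ρ ^ 8 + ρ ^ 7))ᶜ, zd w x)) +
          2 * ((F.card : ℝ) * (Cc / ρ ^ 2)))) +
      A₁ * ((∫ x in (⋃ c ∈ F, ball c (ρ ^ 8))ᶜ, zd w x) - (∫ x in (⋃ c ∈ F, ball c (ρ ^ 8 + ρ ^ 7))ᶜ, zd w x)) := by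
  have hρ0 : 0 < ρ := by linarith
  have hm : 0 ≤ Cc / ρ ^ 2 := by positivity
  -- the sum of the pieces is a divergence-free test field
  have hφ0 : ∀ c ∈ F, ∀ x, x ∉ ball c (3 / 2 * ρ ^ 8) → φ c x = 0 := fun c hc x hx =>
    image_eq_zero_of_notMem_tsupport fun h => hx (hφsupp c hc h)
  have hΦ : ContDiff ℝ (⊤ : ℕ∞) fun y => ∑ c ∈ F, φ c y := contDiff_finset_sum hφs
  have hΦc : HasCompactSupport fun y => ∑ c ∈ F, φ c y := hasCompactSupport_finset_sum hφ0
  have hΦdiv : VectorCalculus.IsDivFree fun y => ∑ c ∈ F, φ c y :=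
    isDivFree_finset_sum (fun c hc => (hφs c hc).differentiable (by simp)) hφdiv
  obtain ⟨hRs, hRdiv, ⟨B', hB'⟩, hR0, hR1, hR2⟩ := KStar.admissible_add_smul hw hdiv hDw h0 h1 h2 hΦ hΦc hΦdiv (-1)
  -- the two regions
  have hBm : MeasurableSet (⋃ c ∈ F, ball c (ρ ^ 8 + ρ ^ 7))ᶜ := (Finset.measurableSet_biUnion _ fun c _ => measurableSet_ball).compl
  have hBpm : MeasurableSet (⋃ c ∈ F, ball c (ρ ^ 8))ᶜ := (Finset.measurableSet_biUnion _ fun c _ => measurableSet_ball).compl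
  have hsubB : (⋃ c ∈ F, ball c (ρ ^ 8 + ρ ^ 7))ᶜ ⊆ (⋃ c ∈ F, ball c (ρ ^ 8))ᶜ :=
    Set.compl_subset_compl.2 (Set.iUnion₂_mono fun c _ => ball_subset_ball (by nlinarith [pow_pos hρ0 7]))
  -- the remainder weight
  obtain ⟨hχR01, hχRone, hχRout⟩ := remainder_weight (χ := χ) hρ hsep hχ01 hχone hχout
  have hχRc : Continuous fun x => 1 - ∑ c ∈ F, χ c x := continuous_const.sub (continuous_finsetSum _ fun c hc => hχcont c hc)
  -- offsets
  obtain ⟨heR1, hiR1, hjR1, heR2, hiR2, hjR2⟩ := remainder_offsets (S := S) hρ hsep hw hφs he1 hi1 hj1 he2 hi2 hj2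
  have hMR := remainder_norm_le (φ := φ) hρ hCc hsep hw1 hχ01 hχsupp hd0 hd0'
  have hDR := remainder_fderiv_sub_norm_le (χ := χ) hρ hCc hsep hw hφs hχsupp hd1 hd1'
  -- the sharp inequality with excess over the inner region, then the outer region
  have hinner := piece_excess_adm (w := w) (φ := fun y => w y + (-1 : ℝ) • ∑ c ∈ F, φ c y) (χ := fun x => 1 - ∑ c ∈ F, χ c x)
    hw hDw h1 h2 hRs hRdiv hB' hR0 hR1 hR2 hm hMR hBm hBpm hsubB hχRc hχR01 hχRone hχRout heR1 hiR1 hjR1 heR2 hiR2 hjR2 hm hDR ht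
  have houter := outer_excess_le (w := w) hw hDw h1 h2 hBm hBpm hsubB
  linarith only [hinner, houter]

end RemainderExcess

end Summit.NavierStokesRegularity.NavierStokesRegularity.Theorems.NearExtremalTransiencePerFlow.TwoThirds

end
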